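import Summits.BirchSwinnertonDyer.BirchSwinnertonDyer.Theorems.KimAtThreeFineKatoOuterRescale
import Summits.BirchSwinnertonDyer.BirchSwinnertonDyer.Theorems.KatoDescentPotSupersingularZetaBodyScaling
import HarnessLib

/-!
# No free lunch for the position clause: POS is NOT a `∀`-consequence of Kato's `∃`-packaged print
# (crux `KatoKuriharaPortThreeShared` = stmt-BirchSwinnertonDyer-19560; cell `bsd-addord`, seat w2-acc5 gen 8;
# `--supports 19560`, helper — a kernel NEGATIVE/TOOL record, closes nothing)

HONEST FRAMING.  TOOL theorems only (no definition, no named fact, no instance, no `sorry`); the cite facts (P123)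
`cupLogInjective_and_hasDualExp_of_isDeRham`, (DR) `isDeRham_restrictedRationalTateRep` and (S5b)
`exists_smul_range_expStarCoord_iff_trace_log` enter as HYPOTHESES; nothing is closed or booked; BSD / 19560 are NOT
proved (or disproved) by this file.

WHAT.  The displayed residual of crux 19560 (skeleton v4/v5, LEAD kim3 g16/g17) is «FOUR cite facts ∧ hKatoPrintPos₀»,
and hKatoPrintPos₀ = Kato 2004's printed clauses over the DEFINED dual exponential ((C1)(C2)(C4)(C5) of
`Kato2004.EulerSystemValues.ZetaBody`, (RES₀)/(DEF₀)) **plus ONE non-print conjunct**, w2-acc4's POSITION clause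
`POS(d, κ) := ∃ u : ℚ, u = κ ∧ ∀ hinj hex (e ≠ 0), hdual(e • d) → v_p(u) = v(ι e)`
(`KimAtThreeFineKatoOuterRescale.exists_dual_unit_of_position`; kim3 `KimAtThreeFineKatoPositionUnit.pos_of_exists`).
The LEAD's design keeps POS INSIDE Kato's existential, glued to Kato's OWN witnesses `(κ, z, x)` (hKatoLitPos :=
«Lit body ∧ POS» under one `∃`).  THIS FILE certifies in the kernel why the cheaper decoupled shape is unavailable:

* `zetaFamily_smul` — with the value datum `Λ` (e.g. the DEFINED `katoLambda`) and the embeddings `ι` FIXED, the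
  family «∀ (c d a A) guards, ∃ z x, ZetaBody W p f ι κ Λ c d a A z x» is closed under `κ ↦ n·κ` (`n : ℕ`): Kato's
  witnesses rescale as `(z, x) ↦ (n • z, n·x)` (bsd-potss-kmc's `ZetaBodyScaling.zetaBody_smul`: (C1)/(C2) are
  `ℤ_p`-linear in `z`, (C4) is `Λ`-linear, (C5) is `ℚ`-linear in `x` and `κ`).
* `padicValRat_eq_of_pos_of_pos` — ONE duality-normalising scalar `e` of the line `d` pins `v_p(u)` for every
  rational `u` in position: `POS(d, u) ∧ POS(d, u′) ⇒ v_p(u) = v_p(u′)`.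
* `not_forall_zetaFamily_pos` — hence, as soon as the family is inhabited for some `κ ≠ 0` (Kato's theorem) and the
  line `d` has a duality-normalising rescaling (cite facts (P123) ∧ (DR) ∧ (S5b), w2-c3's `hinj_hex_of_facts` and
  `hdual_of_facts_of_ringHom`), the `∀`-bridge «κ ≠ 0 → family(κ) → POS(d, κ)» is FALSE: it would put both `κ` and
  `p·κ` in position.  So no statement of the shape «(Kato's `∃`-fact) → POS» or «∀ Kato data, POS» can be a lemma or
  a Literature fact; POS is information about Kato's SPECIFIC zeta elements (the Manin-constant / lattice position,
  kim3 KIM3-POS-g16 Thm A: `v_p(κ_W) = −v_p(c_P)`) that the `∃`-packaging of print forgets — w2-acc4's TYPER NOTE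
  (STATUS 2026-08-27 12:3xZ) and acc5 g7 memo §4, now kernel theorems.  The same mechanism was recorded for the
  rank-one residual's Perrin-Riou node by bsd-potss-kmc (`ZetaBodyScaling`, memo KMC-DESCENT v9 §1 F2).

References: K. Kato, Astérisque 295 (2004) Thm. 9.7 (p. 189), Thm. 6.6 (1) (p. 163), Ex. 13.3 (p. 225)
[Kato2004Asterisque]; K. Kato, LNM 1553 (1993) Ch. II §1.2.4, Thm. 1.4.1 [Kato1993LNM1553]; S. Bloch, K. Kato (1990)
§3 Prop. 3.8, Ex. 3.11 [BlochKato1990].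
-/

set_option autoImplicit false
-- the Theorems namespace of a single-conjunct summit repeats the summit name by design (D-0017)
set_option linter.dupNamespace false

noncomputable section

open scoped NumberField NNReal TensorProduct
open Field ValuativeRel IsDedekindDomain NumberField CongruenceSubgroup
open Literature.NumberTheory.GaloisRepresentations
open Literature.NumberTheory.GaloisRepresentations.PeriodRingData
open Literature.NumberTheory.PAdicHodge
open Literature.NumberTheory.EllipticCurves WeierstrassCurve
open Literature.NumberTheory.EllipticCurves.ModularForms
open Literature.NumberTheory.EllipticCurves.Kato2004
open Literature.NumberTheory.EllipticCurves.Kato2004.EulerSystemValues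
open Summit.BirchSwinnertonDyer.BirchSwinnertonDyer.Theorems.KimAtThreeDeepLowerExpStarOmega
open Summit.BirchSwinnertonDyer.BirchSwinnertonDyer.Theorems.KimAtThreeDeepLowerExpStarOmegaPlace
open Summit.BirchSwinnertonDyer.BirchSwinnertonDyer.Theorems.KimAtThreeDeepUpperExpStarFacts
open Summit.BirchSwinnertonDyer.BirchSwinnertonDyer.Theorems.KimAtThreeDeepUpperExpStarFactsCanonical
open Summit.BirchSwinnertonDyer.BirchSwinnertonDyer.Theorems.ZetaBodyScaling
open Summit.BirchSwinnertonDyer.Rank1Residual.GaloisImage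
open Summit.BirchSwinnertonDyer.Rank1Residual.Additive (LocalLog.padicLog)
open Rat.HeightOneSpectrum

namespace Summit.BirchSwinnertonDyer.BirchSwinnertonDyer.Theorems.KimAtThreeFineKatoPositionNoFreeLunch

variable (W : WeierstrassCurve ℚ) [W.IsElliptic] (p : ℕ) [Fact p.Prime]
  (v : HeightOneSpectrum (𝓞 ℚ)) [hv : Fact (((p : ℕ) : 𝓞 ℚ) ∈ v.asIdeal)]

/-! ## (T1) Kato's witness family at a FIXED value datum is closed under `κ ↦ n·κ` -/

section Family

variable {W p}
variable [ContinuousSMul ℤ_[p] (W.tateModule p)] [Module.Free ℤ_[p] (W.tateModule p)]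
  [Module.Finite ℤ_[p] (W.tateModule p)] {N : ℕ} (f : CuspForm (Gamma0 N) 2)
  (ι : (m : ℕ) → (CyclotomicField m ℚ →+* ℂ))
  (Λ : ∀ (k : ℕ) (r : Finset (HeightOneSpectrum (𝓞 ℚ))),
    H1 (tateRep W p) (cycSubgroup p k r) →ₗ[ℤ_[p]] ℚ_[p] ⊗[ℚ] CyclotomicField (cycLevel p k r) ℚ)

omit hv in
/-- **Kato's witness family rescales in the constant** (the value datum `Λ` and the embeddings `ι` FIXED): if for
every admissible `(c, d, a, A)` there are classes `z` and values `x` with `ZetaBody W p f ι κ Λ c d a A z x`, then the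
same holds with `κ` replaced by `n·κ` — take `(n • z, n·x)` (`ZetaBodyScaling.zetaBody_smul`).
[cite: Kato2004Asterisque, Thm. 9.7 (p. 189), Thm. 6.6 (1) (p. 163) and Ex. 13.3 (p. 225)] -/
theorem zetaFamily_smul (n : ℕ) {κ : ℝ}
    (h : ∀ (c d a : ℤ) (A : ℕ), 0 < A → Int.gcd c (6 * p * A) = 1 → Int.gcd d (6 * p * N) = 1 →
      ∃ (z : ∀ (k : ℕ) (r : (cyclotomicLevelsRat p (badPlaces c d A N)).Ideals),
            H1 (tateRep W p) ((cyclotomicLevelsRat p (badPlaces c d A N)).level k r.1))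
        (x : ∀ (k : ℕ) (r : (cyclotomicLevelsRat p (badPlaces c d A N)).Ideals),
            CyclotomicField (cycLevel p k r.1) ℚ),
        ZetaBody W p f ι κ Λ c d a A z x) :
    ∀ (c d a : ℤ) (A : ℕ), 0 < A → Int.gcd c (6 * p * A) = 1 → Int.gcd d (6 * p * N) = 1 →
      ∃ (z : ∀ (k : ℕ) (r : (cyclotomicLevelsRat p (badPlaces c d A N)).Ideals),
            H1 (tateRep W p) ((cyclotomicLevelsRat p (badPlaces c d A N)).level k r.1))
        (x : ∀ (k : ℕ) (r : (cyclotomicLevelsRat p (badPlaces c d A N)).Ideals),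
            CyclotomicField (cycLevel p k r.1) ℚ),
        ZetaBody W p f ι ((n : ℝ) * κ) Λ c d a A z x := by
  intro c d a A hA hc hd
  obtain ⟨z, x, hz⟩ := h c d a A hA hc hd
  exact ⟨(n : ℤ_[p]) • z, fun k r ↦ (n : CyclotomicField (cycLevel p k r.1) ℚ) * x k r, zetaBody_smul n hz⟩

end Family

/-! ## (T2) One duality-normalising scalar pins the position -/

/-- **Two rationals in position relative to the same line have the same `p`-adic valuation**, as soon as ONE
duality-normalising rescaling `e • d` of the line exists (with its Prop-1.2.3 binders): both valuations equal
`v(ι e)`.  (The `∀ hinj hex e he, hdual(e • d) → …` clause is w2-acc4's POS, verbatim.)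
[cite: Kato1993LNM1553, Ch. II §1.2.4 and Thm. 1.4.1] [cite: BlochKato1990, §3 (Prop. 3.8, Ex. 3.11)] -/
theorem padicValRat_eq_of_pos_of_pos [W.IsGloballyMinimal]
    (ι : Place.Completion (Sum.inr v : Place ℚ) →+* ℚ_[p]) :
    letI := valuativeRelPlace v
    letI := topologicalSpacePlace v
    haveI := isNonarchimedeanLocalField_place v
    haveI := charZero_place v
    letI := padicAlgebraPlace p v
    haveI := fact_not_isUnit_place p v
    haveI := isAdicComplete_place p v
    ∀ (d : LocalNeronLineAt W p v)
    (hinj : (bdRPeriodRingData (valuation_place_lt_one p v)).CupLogInjective (logCyclotomic p)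
      (localRationalTateRep W p (galRestrictPlace v)))
    (hex : ∀ z : contOneCocycles (localRationalTateRep W p (galRestrictPlace v)).toTopRep,
      (bdRPeriodRingData (valuation_place_lt_one p v)).HasDualExp (logCyclotomic p)
        (localRationalTateRep W p (galRestrictPlace v)) fun σ => z.1 σ)
    (e : Place.Completion (Sum.inr v : Place ℚ)) (he : e ≠ 0)
    (hdual : ∀ a : ℚ_[p], (∃ y, expStarOmegaPadicAt (d.smul e he) hinj hex ι y = a) ↔
      ∀ Q : (W.baseChange ℚ_[p]).toAffine.Point, ‖a * LocalLog.padicLog (W.baseChange ℚ_[p]) Q‖ ≤ 1)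
    (u u' : ℚ)
    (hu : ∀ (hinj : (bdRPeriodRingData (valuation_place_lt_one p v)).CupLogInjective (logCyclotomic p)
        (localRationalTateRep W p (galRestrictPlace v)))
      (hex : ∀ z : contOneCocycles (localRationalTateRep W p (galRestrictPlace v)).toTopRep,
        (bdRPeriodRingData (valuation_place_lt_one p v)).HasDualExp (logCyclotomic p)
          (localRationalTateRep W p (galRestrictPlace v)) fun σ => z.1 σ)
      (e : Place.Completion (Sum.inr v : Place ℚ)) (he : e ≠ 0),
      (∀ a : ℚ_[p], (∃ y, expStarOmegaPadicAt (d.smul e he) hinj hex ι y = a) ↔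
        ∀ Q : (W.baseChange ℚ_[p]).toAffine.Point, ‖a * LocalLog.padicLog (W.baseChange ℚ_[p]) Q‖ ≤ 1) →
      padicValRat p u = (ι e).valuation)
    (hu' : ∀ (hinj : (bdRPeriodRingData (valuation_place_lt_one p v)).CupLogInjective (logCyclotomic p)
        (localRationalTateRep W p (galRestrictPlace v)))
      (hex : ∀ z : contOneCocycles (localRationalTateRep W p (galRestrictPlace v)).toTopRep,
        (bdRPeriodRingData (valuation_place_lt_one p v)).HasDualExp (logCyclotomic p)
          (localRationalTateRep W p (galRestrictPlace v)) fun σ => z.1 σ)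
      (e : Place.Completion (Sum.inr v : Place ℚ)) (he : e ≠ 0),
      (∀ a : ℚ_[p], (∃ y, expStarOmegaPadicAt (d.smul e he) hinj hex ι y = a) ↔
        ∀ Q : (W.baseChange ℚ_[p]).toAffine.Point, ‖a * LocalLog.padicLog (W.baseChange ℚ_[p]) Q‖ ≤ 1) →
      padicValRat p u' = (ι e).valuation),
    padicValRat p u = padicValRat p u' :=
  fun _d hinj hex e he hdual _u _u' hu hu' ↦ (hu hinj hex e he hdual).trans (hu' hinj hex e he hdual).symm

/-! ## (T3) The `∀`-bridge «Kato family → POS» is false -/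

/-- **No free lunch for POS.**  Fix a place `v ∋ p`, an identification `ι : ℚ_v → ℚ_p`, a local Néron line `d`,
the newform-side data `(f, ιC)` and ANY value datum `Λ` (e.g. the DEFINED `katoLambda`).  Assume the cite facts
(P123), (DR), (S5b), and that Kato's family is inhabited for some real constant `κ ≠ 0` (Kato 2004, Ex. 13.3 with
Thm. 9.7 / 6.6 (1): the content of `Kato2004.exists_eulerSystem_[definedExpStar_]values`).  Then it is FALSE that
every nonzero constant `κ` carrying a Kato family is in position relative to `d`: by `zetaFamily_smul` the constant
`p·κ` carries one too, and by `padicValRat_eq_of_pos_of_pos` (with the duality-normalising scalar supplied by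
(S5b), w2-c3's `hdual_of_facts_of_ringHom`) both `κ = u` and `p·κ = u′` would have the same valuation, whereas
`v_p(p·u) = v_p(u) + 1`.  CONSEQUENCE for the 19560 residual: POS cannot be split off Kato's existential as a
separate `∀`-statement or derived from the `∃`-fact; it must stay glued to Kato's own witnesses (hKatoLitPos).
[cite: Kato2004Asterisque, Thm. 9.7 (p. 189), Thm. 6.6 (1) (p. 163) and Ex. 13.3 (p. 225)]
[cite: Kato1993LNM1553, Ch. II §1.2.4 and Thm. 1.4.1] [cite: BlochKato1990, §3 (Prop. 3.8, Ex. 3.11)] -/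
theorem not_forall_zetaFamily_pos [W.IsGloballyMinimal]
    [ContinuousSMul ℤ_[p] (W.tateModule p)] [Module.Free ℤ_[p] (W.tateModule p)]
    [Module.Finite ℤ_[p] (W.tateModule p)]
    (hP : cupLogInjective_and_hasDualExp_of_isDeRham) (hDR : isDeRham_restrictedRationalTateRep)
    (hT : exists_smul_range_expStarCoord_iff_trace_log)
    (ι : Place.Completion (Sum.inr v : Place ℚ) →+* ℚ_[p])
    {N : ℕ} (f : CuspForm (Gamma0 N) 2) (ιC : (m : ℕ) → (CyclotomicField m ℚ →+* ℂ))
    (Λ : ∀ (k : ℕ) (r : Finset (HeightOneSpectrum (𝓞 ℚ))),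
      H1 (tateRep W p) (cycSubgroup p k r) →ₗ[ℤ_[p]] ℚ_[p] ⊗[ℚ] CyclotomicField (cycLevel p k r) ℚ)
    (hinh : ∃ κ : ℝ, κ ≠ 0 ∧
      ∀ (c d a : ℤ) (A : ℕ), 0 < A → Int.gcd c (6 * p * A) = 1 → Int.gcd d (6 * p * N) = 1 →
        ∃ (z : ∀ (k : ℕ) (r : (cyclotomicLevelsRat p (badPlaces c d A N)).Ideals),
              H1 (tateRep W p) ((cyclotomicLevelsRat p (badPlaces c d A N)).level k r.1))
          (x : ∀ (k : ℕ) (r : (cyclotomicLevelsRat p (badPlaces c d A N)).Ideals),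
              CyclotomicField (cycLevel p k r.1) ℚ),
          ZetaBody W p f ιC κ Λ c d a A z x) :
    letI := valuativeRelPlace v
    letI := topologicalSpacePlace v
    haveI := isNonarchimedeanLocalField_place v
    haveI := charZero_place v
    letI := padicAlgebraPlace p v
    haveI := fact_not_isUnit_place p v
    haveI := isAdicComplete_place p v
    ∀ (d : LocalNeronLineAt W p v), ¬ ∀ κ : ℝ, κ ≠ 0 →
      (∀ (c d a : ℤ) (A : ℕ), 0 < A → Int.gcd c (6 * p * A) = 1 → Int.gcd d (6 * p * N) = 1 →
        ∃ (z : ∀ (k : ℕ) (r : (cyclotomicLevelsRat p (badPlaces c d A N)).Ideals),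
              H1 (tateRep W p) ((cyclotomicLevelsRat p (badPlaces c d A N)).level k r.1))
          (x : ∀ (k : ℕ) (r : (cyclotomicLevelsRat p (badPlaces c d A N)).Ideals),
              CyclotomicField (cycLevel p k r.1) ℚ),
          ZetaBody W p f ιC κ Λ c d a A z x) →
      ∃ u : ℚ, (u : ℝ) = κ ∧
        ∀ (hinj : (bdRPeriodRingData (valuation_place_lt_one p v)).CupLogInjective (logCyclotomic p)
            (localRationalTateRep W p (galRestrictPlace v)))
          (hex : ∀ z : contOneCocycles (localRationalTateRep W p (galRestrictPlace v)).toTopRep,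
            (bdRPeriodRingData (valuation_place_lt_one p v)).HasDualExp (logCyclotomic p)
              (localRationalTateRep W p (galRestrictPlace v)) fun σ => z.1 σ)
          (e : Place.Completion (Sum.inr v : Place ℚ)) (he : e ≠ 0),
          (∀ a : ℚ_[p], (∃ y, expStarOmegaPadicAt (d.smul e he) hinj hex ι y = a) ↔
            ∀ Q : (W.baseChange ℚ_[p]).toAffine.Point, ‖a * LocalLog.padicLog (W.baseChange ℚ_[p]) Q‖ ≤ 1) →
          padicValRat p u = (ι e).valuation := by
  intro d H
  obtain ⟨κ, hκ0, hfam⟩ := hinh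
  have hp1 : 1 < p := (Fact.out : p.Prime).one_lt
  have hpR : ((p : ℕ) : ℝ) ≠ 0 := by exact_mod_cast (Fact.out : p.Prime).ne_zero
  -- the family for `p·κ`
  have hfam' := zetaFamily_smul (W := W) (p := p) f ιC Λ p hfam
  have hκ0' : ((p : ℕ) : ℝ) * κ ≠ 0 := mul_ne_zero hpR hκ0
  -- both `κ` and `p·κ` in position
  obtain ⟨u, hu, hpos⟩ := H κ hκ0 hfam
  obtain ⟨u', hu', hpos'⟩ := H (((p : ℕ) : ℝ) * κ) hκ0' hfam'
  -- one duality-normalising scalar from the cite facts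
  obtain ⟨hinj, hex⟩ := hinj_hex_of_facts W p v hP hDR
  obtain ⟨e, he, hdual⟩ := hdual_of_facts_of_ringHom W p v hT d hinj hex ι
  have hval : padicValRat p u = padicValRat p u' :=
    padicValRat_eq_of_pos_of_pos W p v ι d hinj hex e he hdual u u' hpos hpos'
  -- but `u' = p·u`
  have hu0 : u ≠ 0 := by
    rintro rfl
    exact hκ0 (by rw [← hu]; push_cast; rfl)
  have huu' : u' = (p : ℚ) * u := by
    have h1 : ((u' : ℚ) : ℝ) = (((p : ℚ) * u : ℚ) : ℝ) := by rw [hu', ← hu]; push_cast; ring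
    exact_mod_cast h1
  have hpq : (p : ℚ) ≠ 0 := by exact_mod_cast (Fact.out : p.Prime).ne_zero
  rw [huu', padicValRat.mul hpq hu0, padicValRat.self hp1] at hval
  omega

end Summit.BirchSwinnertonDyer.BirchSwinnertonDyer.Theorems.KimAtThreeFineKatoPositionNoFreeLunch

end
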